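import Summits.ResolutionOfSingularities.ResolutionOfSingularities.Theorems.EquisingularLiftEquisingularLiftNatVertexLineChartA
import Summits.ResolutionOfSingularities.ResolutionOfSingularities.Theorems.EquisingularLiftEquisingularLiftNatVanishingIdealOfChart
import Literature.AlgebraicGeometry.Resolution.VertexBlowupProjectionMorphism
import HarnessLib

/-!
# [OURS · L1 W4.5(b) · EL♮(3) · nose residue, D3-9 file 3/5] The strict transform of the vertex line on the VERTEX CHART — SECTIONS:
# generators `X_j/X_{i₀}` of `𝓘⟨Z′⟩` over the chart, the coordinate `X_{i₀}`, quasi-regularity, and the overlap with `b⁻¹D₊(x_{i₀})`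

Crux chain w45b, child EL♮(3) = stmt-ResolutionOfSingularities-20148; desk table D3, row **D3-9** (res-L1-w45b-nose-w3 g2).
`--supports stmt-ResolutionOfSingularities-20148 --as helper`. OURS; NOT a statement of any manuscript; AI-written, weaker than expert review.
No `sorry`; standard axioms; DEF-FREE (the de Jong kit's `attribute [local instance] MvPolynomial.gradedAlgebra` is needed to write `Proj k[x]`).

Setting: ANY blowing up `b : P̃ ⟶ ℙ^{d+1}_k` of the vertex; `c = vertexChart hb i₀ : Spec Cᵢ₀ ⟶ P̃`; `A = c(Spec Cᵢ₀)`; the chart isomorphism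
`θ = ΓSpecIso ∘ c.appIso ⊤ : Γ(P̃, A) ≅ Cᵢ₀`; the linear system `z = blowupRatFn b` (`z_j = b^*(x_j/x_{d+1})`) with its charts `lsChart z i ⊇ A`
and ratio sections `lsRatio z i₀ a` (rational function `z_a/z_{i₀}`) — tree `VertexBlowupRationalFunctions/ProjectionMorphism`. PROVED:

* `image_top_le_lsChart` (`A ⊆ lsChart z i₀`); `lineGenA` := `lsRatio z i₀ (i₀.succAbove m)|_A` has `θ (lineGenA m) = X_{succAbove m}/X_{i₀}`
  (`chartRingEquiv_lineGenA`, from ✓ `appLE_lsRatio_eq`); ★ **`span_lineGenA_eq_vanishingIdeal`** — they GENERATE `𝓘⟨vertexLineStrict b i₀⟩(A)`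
  (✓ `preimage_vertexChart_vertexLineStrict` + ✓ `span_range_eq_vanishingIdeal_ideal`); ★ `isQuasiRegular_lineGenA` (distinct variables of
  `k[Y][T] ≅ Cᵢ₀` are weakly regular, transported);
* the coordinate `lineCoordA := b^*(x_{i₀}/x_{d+1})|_A` has `θ (lineCoordA) = X_{i₀}` (`chartRingEquiv_lineCoordA`, from ✓ `appIso_hom_blowupSection`) and
  ★ **`image_top_inf_preimage_basicOpen_eq`**: `A ∩ b⁻¹D₊(x_{i₀}) = D(lineCoordA)` (the overlap of the two charts is the basic open of the coordinate).

(The sections are written as explicit restrictions — no new definitions; the names above are those of the theorems.) Next: `…ChartB` (the chart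
`b⁻¹D₊(x_{i₀})`) and `…Unobs` (the `DirStepUnobs` certificate via ✓ `dirStepUnobs_univ_of_charts`).
References (index only): A. J. de Jong (1996), proof of Lemma 4.11 [cite: DeJong1996]; The Stacks Project, Tag 0804 [cite: StacksProject];
R. Hartshorne (1977), II §7, II Thm. 7.1 [cite: Hartshorne1977].
-/

set_option linter.dupNamespace false -- mandated namespace `Summit.<Summit>.<Problem>` of this single-conjunct summit

noncomputable section

open CategoryTheory AlgebraicGeometry TopologicalSpace HomogeneousLocalization Topology Opposite
open Literature.AlgebraicGeometry.Resolution Literature.AlgebraicGeometry.Resolution.DeJong1996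
open Literature.AlgebraicGeometry.Resolution.PointBlowup (Chart Base frac exc polyEquiv polyHom baseHom originIdeal)
open Literature.AlgebraicGeometry.Motives.Segre (grading X_mem)

attribute [local instance] MvPolynomial.gradedAlgebra

namespace Summit.ResolutionOfSingularities.ResolutionOfSingularities.Cruxes.EquisingularLiftNat.Sections

/-! ## Algebra: the generators `X_j/X_{i₀}`, `j ≠ i₀`, enumerated by `Fin d`, form a quasi-regular sequence -/

section Algebra

variable {d : ℕ} {k : Type} [Field k] (i₀ : Fin (d + 1))

/-- `frac '' {i₀}ᶜ` is the range of `m ↦ X_{succAbove m}/X_{i₀}`. [folklore] -/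
theorem range_frac_succAbove :
    Set.range (fun m : Fin d => frac d k i₀ (i₀.succAbove m)) = frac d k i₀ '' {i₀}ᶜ := by
  rw [Set.range_comp' (frac d k i₀) i₀.succAbove, Fin.range_succAbove]

/-- **The `X_j/X_{i₀}`, `j ≠ i₀`, form a quasi-regular sequence of `Cᵢ₀ ≅ k[Y_j : j ≠ i₀][T]`** (they are distinct variables of the polynomial
ring `k[Y, T]`; distinct variables are weakly regular, `MvPolynomial.isWeaklyRegular_map_X`; transport along `sumAlgEquiv` and `polyEquiv`).
[cite: Matsumura1987, Thm. 16.2 (i)] (folklore instance) -/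
theorem isQuasiRegular_frac_succAbove : IsQuasiRegular (fun m : Fin d => frac d k i₀ (i₀.succAbove m)) := by
  let e : MvPolynomial (Unit ⊕ {j : Fin (d + 1) // j ≠ i₀}) k ≃+* Chart d k i₀ :=
    (MvPolynomial.sumAlgEquiv k Unit {j : Fin (d + 1) // j ≠ i₀}).toRingEquiv.trans (polyEquiv d k i₀)
  let v : Fin d → Unit ⊕ {j : Fin (d + 1) // j ≠ i₀} := fun m => Sum.inr ⟨i₀.succAbove m, Fin.succAbove_ne i₀ m⟩
  have hv : Function.Injective v := fun m m' h => by
    simpa [v, Subtype.mk.injEq, Fin.succAbove_right_inj] using h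
  have he : (fun m : Fin d => frac d k i₀ (i₀.succAbove m)) = e ∘ fun m => MvPolynomial.X (v m) := by
    funext m
    change frac d k i₀ (i₀.succAbove m) = polyEquiv d k i₀ ((MvPolynomial.sumAlgEquiv k Unit {j : Fin (d + 1) // j ≠ i₀}) (MvPolynomial.X (v m)))
    rw [MvPolynomial.sumAlgEquiv_X_inr, PointBlowup.polyEquiv_apply, PointBlowup.polyHom_C, PointBlowup.baseHom_X]
  rw [he]
  refine IsQuasiRegular.map_ringEquiv (isQuasiRegular_of_isWeaklyRegular _ ?_) e
  have h := MvPolynomial.isWeaklyRegular_map_X (R := k) (List.ofFn v) (List.nodup_ofFn.mpr hv)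
  rwa [List.map_ofFn] at h

end Algebra

/-! ## Sections on the vertex chart -/

section Sections

variable {d : ℕ} {k : Type} [Field k] {P : Scheme.{0}} (b : P ⟶ Proj (grading (Fin (d + 1 + 1)) k)) [IsIntegral P] [IsDominant b]
  (hb : IsBlowup b (vertexIdealSheaf d k)) (i₀ : Fin (d + 1))

/-- `c(Spec Cᵢ₀) ⊆ lsChart z i₀` (the chart of the linear system where `z_{i₀}` generates). [folklore] -/
theorem image_top_le_lsChart : vertexChart hb i₀ ''ᵁ ⊤ ≤ lsChart (blowupRatFn b) i₀ :=
  (Scheme.Hom.image_top_eq_opensRange _).le.trans (opensRange_vertexChart_le_lsChart b hb i₀)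

/-- **The generators pulled back to the chart**: `θ (lsRatio z i₀ a|_A) = X_a/X_{i₀}`. [folklore] -/
theorem chartRingEquiv_lsRatio (a : Fin (d + 1)) :
    (Scheme.ΓSpecIso (.of (Chart d k i₀))).hom (((vertexChart hb i₀).appIso ⊤).hom
      (P.presheaf.map (homOfLE (image_top_le_lsChart b hb i₀)).op (lsRatio (blowupRatFn b) i₀ a))) = frac d k i₀ a := by
  have h1 : ((vertexChart hb i₀).appIso ⊤).hom
      (P.presheaf.map (homOfLE (image_top_le_lsChart b hb i₀)).op (lsRatio (blowupRatFn b) i₀ a)) =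
      (Scheme.ΓSpecIso (.of (Chart d k i₀))).inv (frac d k i₀ a) := by
    rw [Scheme.Hom.appIso_hom', ← CommRingCat.comp_apply, Scheme.Hom.map_appLE, appLE_lsRatio_eq b hb i₀ a]
  rw [h1, ← CommRingCat.comp_apply, Iso.inv_hom_id, CommRingCat.id_apply]

omit [IsIntegral P] [IsDominant b] in
/-- **The coordinate pulled back to the chart**: `θ (b^*(x_{i₀}/x_{d+1})|_A) = X_{i₀}`. [folklore] -/
theorem chartRingEquiv_blowupSection :
    (Scheme.ΓSpecIso (.of (Chart d k i₀))).hom (((vertexChart hb i₀).appIso ⊤).hom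
      (P.presheaf.map (homOfLE (image_top_le_preimage_lastChart b hb i₀)).op (blowupSection b i₀))) = exc d k i₀ := by
  rw [appIso_hom_blowupSection b hb i₀ i₀, PointBlowup.frac_self, mul_one, ← CommRingCat.comp_apply, Iso.inv_hom_id, CommRingCat.id_apply]

/-- ★ **The `lsRatio z i₀ (succAbove m)|_A`, `m < d`, generate `𝓘⟨vertexLineStrict b i₀⟩(A)`** (`A = c(Spec Cᵢ₀)`): through `θ` they are the
`X_j/X_{i₀}`, `j ≠ i₀`, which generate the prime ideal cutting out `c⁻¹(vertexLineStrict)`. [cite: Hartshorne1977, II Example 3.2.6]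
(OURS computation; folklore) -/
theorem span_lsRatio_eq_vanishingIdeal :
    Ideal.span (Set.range fun m : Fin d =>
        P.presheaf.map (homOfLE (image_top_le_lsChart b hb i₀)).op (lsRatio (blowupRatFn b) i₀ (i₀.succAbove m))) =
      (Scheme.IdealSheafData.vanishingIdeal ⟨vertexLineStrict b i₀, isClosed_vertexLineStrict b i₀⟩).ideal
        ⟨vertexChart hb i₀ ''ᵁ ⊤, isAffineOpen_image_top (vertexChart hb i₀)⟩ :=
  span_range_eq_vanishingIdeal_ideal (vertexChart hb i₀) ⟨vertexLineStrict b i₀, isClosed_vertexLineStrict b i₀⟩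
    (Ideal.span (frac d k i₀ '' {i₀}ᶜ)) (isPrime_span_frac i₀).isRadical (preimage_vertexChart_vertexLineStrict hb i₀)
    (fun m : Fin d => frac d k i₀ (i₀.succAbove m)) (by rw [range_frac_succAbove]) _ (fun m => chartRingEquiv_lsRatio b hb i₀ _)

/-- ★ **The restricted generators form a quasi-regular sequence of `Γ(P̃, A)`** (transport of `isQuasiRegular_frac_succAbove` along `θ⁻¹`).
[cite: Matsumura1987, Thm. 16.2 (i)] (OURS instance) -/
theorem isQuasiRegular_lsRatio :
    IsQuasiRegular (fun m : Fin d =>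
      P.presheaf.map (homOfLE (image_top_le_lsChart b hb i₀)).op (lsRatio (blowupRatFn b) i₀ (i₀.succAbove m))) := by
  let θ : Γ(P, vertexChart hb i₀ ''ᵁ ⊤) ≃+* Chart d k i₀ :=
    ((vertexChart hb i₀).appIso ⊤ ≪≫ Scheme.ΓSpecIso (.of (Chart d k i₀))).commRingCatIsoToRingEquiv
  have h : (fun m : Fin d => P.presheaf.map (homOfLE (image_top_le_lsChart b hb i₀)).op (lsRatio (blowupRatFn b) i₀ (i₀.succAbove m))) =
      θ.symm ∘ fun m : Fin d => frac d k i₀ (i₀.succAbove m) := by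
    funext m
    apply θ.injective
    change _ = θ (θ.symm _)
    rw [RingEquiv.apply_symm_apply]
    exact chartRingEquiv_lsRatio b hb i₀ (i₀.succAbove m)
  rw [h]
  exact (isQuasiRegular_frac_succAbove i₀).map_ringEquiv θ.symm

omit [IsIntegral P] [IsDominant b] in
/-- ★ **The overlap of the two charts is the basic open of the coordinate**: `A ∩ b⁻¹D₊(x_{i₀}) = D(b^*(x_{i₀}/x_{d+1})|_A)` — a point `c 𝔭`
lies over `D₊(x_{i₀})` iff `X_{i₀} ∉ 𝔭`. [cite: StacksProject, Tag 0804] (OURS computation; folklore) -/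
theorem image_top_inf_preimage_basicOpen_eq :
    vertexChart hb i₀ ''ᵁ ⊤ ⊓ b ⁻¹ᵁ Proj.basicOpen (grading (Fin (d + 1 + 1)) k) (MvPolynomial.X (Fin.castSucc i₀)) =
      P.basicOpen (P.presheaf.map (homOfLE (image_top_le_preimage_lastChart b hb i₀)).op (blowupSection b i₀)) := by
  -- the basic open as an image under the chart
  have h1 : P.basicOpen (P.presheaf.map (homOfLE (image_top_le_preimage_lastChart b hb i₀)).op (blowupSection b i₀)) =
      vertexChart hb i₀ ''ᵁ (Spec (.of (Chart d k i₀))).basicOpen (((vertexChart hb i₀).appIso ⊤).hom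
        (P.presheaf.map (homOfLE (image_top_le_preimage_lastChart b hb i₀)).op (blowupSection b i₀))) := by
    rw [Scheme.image_basicOpen, Iso.hom_inv_id_apply]
  have h2 : (Spec (.of (Chart d k i₀))).basicOpen (((vertexChart hb i₀).appIso ⊤).hom
        (P.presheaf.map (homOfLE (image_top_le_preimage_lastChart b hb i₀)).op (blowupSection b i₀))) =
      PrimeSpectrum.basicOpen (exc d k i₀) := by
    rw [basicOpen_eq_of_affine', chartRingEquiv_blowupSection b hb i₀]
  -- the overlap as an image under the chart
  have h3 : vertexChart hb i₀ ''ᵁ ⊤ ⊓ b ⁻¹ᵁ Proj.basicOpen (grading (Fin (d + 1 + 1)) k) (MvPolynomial.X (Fin.castSucc i₀)) =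
      vertexChart hb i₀ ''ᵁ (vertexChart hb i₀ ⁻¹ᵁ b ⁻¹ᵁ Proj.basicOpen (grading (Fin (d + 1 + 1)) k) (MvPolynomial.X (Fin.castSucc i₀))) := by
    rw [Scheme.Hom.image_preimage_eq_opensRange_inf, Scheme.Hom.image_top_eq_opensRange]
  -- the two opens of `Spec Cᵢ₀` coincide pointwise
  have h4 : vertexChart hb i₀ ⁻¹ᵁ b ⁻¹ᵁ Proj.basicOpen (grading (Fin (d + 1 + 1)) k) (MvPolynomial.X (Fin.castSucc i₀)) =
      PrimeSpectrum.basicOpen (exc d k i₀) := by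
    ext 𝔭
    change b (vertexChart hb i₀ 𝔭) ∈ Proj.basicOpen (grading (Fin (d + 1 + 1)) k) (MvPolynomial.X (Fin.castSucc i₀)) ↔
      𝔭 ∈ PrimeSpectrum.basicOpen (exc d k i₀)
    rw [vertexChart_comp_apply hb i₀ 𝔭, Proj.mem_basicOpen, X_castSucc_mem_awayι_iff, chartGen_mem_iff i₀ 𝔭]
    rfl
  rw [h1, h2, h3, h4]

end Sections

end Summit.ResolutionOfSingularities.ResolutionOfSingularities.Cruxes.EquisingularLiftNat.Sections

end
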